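import Summits.HodgeConjecture.HodgeConjecture.Theorems.F0P2mFinIsotypy                -- ★ p822962 F0P2-p01 (g6): its import cone = ★ CI road + ★ P3 bricks I♭ ∕ (b2′) used below
import Literature.NumberTheory.Automorphic.Liu2021.Def412AdmissibleIffParity           -- ★ `IsAdmissibleElement` vocabulary of the (C♯) texts (as in the sub-line)
import Literature.NumberTheory.QuadraticForms.PrescribedNormClassesCM                  -- ★ (as in the sub-line's imports; opens below)
import Literature.NumberTheory.Rogawski1990.CohomologicalFinComponentIsTheta           -- ★ letter (C) `cohFinComponent_isTheta` — THE CONCLUSION, BY NAME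
import Summits.HodgeConjecture.CorCM.B01.Transposition.Item6OmegaChiSplitting         -- ★ `isCompatible_chiSplittingLine` family (as in the sub-line)
import HarnessLib

/-!
# Crux `H413` · programme P2 · E3 rung 3 — **LETTER (C) RETIRED BY DERIVATION: `cohFinComponent_isTheta ⟸ (C♯)hol + conj`**, Lines-free
# (`cohFinComponent_isTheta_of_cSharp`; desk N121-1, F0P2-plan (g7) 2026-08-31T12:04:49Z ∕ 12:57:28Z «(C) scheduled for retirement by derivation»)

Cell hodgecm-mathlib (D-0151), FLOOR 0, crux item H413 = stmt-HodgeConjecture-24833; sub-line `Cruxes/H413/Lines/F0_P2E3Rung3.lean` edition v1.1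
(F0P2-plan (g7), commit edad36618858, sha16 0929a40a859b4f2f; registered open stubs `stub_CSharp_hol : StubCSharpHol` :558 (ENGINE) and
`stub_CSharp_antihol_of_hol : StubCSharpHol → StubCSharpAntihol` :567 (B-p18 (g27))).  Author F0P2-p02 (g5) (row (R1) = desk N121-1, bus
2026-08-31T12:55:46Z).  THEOREMS ONLY (no `def`, no instance, no notation, no named fact, no `sorry`); kernel lane `--supports stmt-HodgeConjecture-24833
--as helper`; never imports a `Cruxes/…/Lines` module (ref1 O50-1) — the two registered (C♯) texts are PASTED VERBATIM as hypothesis types.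
HONEST LABEL: HC_CM is proved only modulo the printed citations until rung 0 closes; this file discharges NO printed citation and introduces none — it
shows, kernel-checked, that the UNSIGNED letter (C) ★ `Literature.NumberTheory.Rogawski1990.cohFinComponent_isTheta` (consumed by ★
`ThetaPinBridge.spectrumIsTheta_of_cohFinComponent_of_master`, ★ `F0P2CohFinComponentIsThetaC.cohFinComponentIsThetaAdm_of_socket` ∕ `H413_of_socketC`) is a
CONSEQUENCE of the SIGNED stubs (C♯)hol + conj, so that booking (C♯)hol (director's option (α), planner spec
`F0/P2/CohomologicalFinComponentIsThetaSigned.spec.F0P2-plan-g7.lean`) can REPLACE (C) count-neutrally: every consumer of (C) is fed by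
`cohFinComponent_isTheta_of_cSharp stub_CSharp_hol stub_CSharp_antihol_of_hol`.

WHY (C) ⟸ (C♯) IS NOT A ONE-LINER.  (C) quantifies over an ARBITRARY irreducible smooth `σ` occurring in the cotangent `P` (`P.HasFinComponent σ`) and
concludes `σ ↪ ω_H(μ, a, χ)` equivariantly; (C♯) has no `σ` and concludes `P.HasFinComponent ω_H(μ, a, χ)` (the carrier occurs in `P`).  The bridge is
Flath's uniqueness of the finite component in its ADMISSIBILITY-FREE form for `σ` (`exists_injective_intertwiningMap_of_hasFinComponent`): the irreducible
ADMISSIBLE carrier `ω` occurring in `P` makes the smooth part `P_f^∞` isotypic of type `ω` (★ P3 brick I♭ `F0P3FinPartIsotypic.isIsotypicOfType_finRep_smoothPart`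
[FlathCorvallis1979, Thm. 3; BorelJacquet1979, §4.6; BourbakiAlgebreVIII2012, VIII §4]); the smooth irreducible `σ` lands in `P_f^∞` (★
`F0P3FinRepConstituentsExist.exists_intertwiningMap_smoothPart_of_hasFinComponent`), so `σ.asModule` is itself isotypic of type `ω` (Mathlib
`IsIsotypicOfType.of_injective`) and, being simple (Mathlib `Representation.irreducible_iff_isSimpleModule_asModule`), is `≃ₗ[ℂ[U(H)(𝔸_f)]] ω.asModule`;
Mathlib `Representation.IntertwiningMap.equivLinearMapAsModule` turns this into an injective equivariant `ℂ`-linear map `σ → ω`.  No admissibility of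
`σ` is used (so (C), not only (C♭), follows); the carriers are irreducible admissible by the ★ CI road (`F0P2cStubCI.rhoAtLine_chi_isIrreducible` ∕
`rhoAtLine_chi_isAdmissible`, [Liu2021, App. D Lem. D.1 (1)] per place ★ inside, `N = 3`).  The SIGN (`IsAdmissibleElement …`) of (C♯) is simply dropped.

Contents: §1 the generic bridge `exists_injective_intertwiningMap_of_hasFinComponent` (any `(F, E, c, N, J)`, any discrete automorphic `P`);
§2 the head `cohFinComponent_isTheta_of_cSharp (hH : ‹StubCSharpHol :221–248 VERBATIM›) (hA : ‹StubCSharpHol› → ‹StubCSharpAntihol :256–283 VERBATIM›) :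
Literature.NumberTheory.Rogawski1990.cohFinComponent_isTheta` (∨-elimination on the Hodge type, then §1 at `ω := ω_H(μ, a, χ)`).
Fold∕use (registrar ∕ (C)-line, textual): `cohFinComponent_isTheta_of_cSharp F0P2E3Rung3.stub_CSharp_hol F0P2E3Rung3.stub_CSharp_antihol_of_hol`, or over
the planner's (α) letters `… (h_hol) (fun _ => h_antihol)`.

## References
* [Liu2021] Y. Liu, *Fourier–Jacobi cycles and arithmetic relative trace formula*, Camb. J. Math. 9 (2021) = arXiv:2102.11518: Def. 4.11–4.12, Prop. 4.13
  (proof l. 2131–2149), App. D Lem. D.1 (1).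
* [Rogawski1990] J. Rogawski, Ann. of Math. Stud. 123 (1990): Thm. 13.3.6 (c), §15.3 ¶1 (the letter (C)).
* [FlathCorvallis1979] D. Flath, PSPM 33.1 (1979), Thm. 3, Thm. 4.  [BorelJacquet1979] A. Borel, H. Jacquet, PSPM 33.1 (1979), §4.6.
* [BourbakiAlgebreVIII2012] N. Bourbaki, *Algèbre* VIII (2012), §4 n°1–2 (isotypic modules).  [Bump1997] D. Bump, CUP (1997), §3.4 Prop. 3.4.1.
-/

set_option autoImplicit false

-- the mandated namespace has the single-problem summit's repeated segment (`HodgeConjecture.HodgeConjecture`)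
set_option linter.dupNamespace false

noncomputable section

namespace Summit.HodgeConjecture.HodgeConjecture.Cruxes.H413.F0P2mCOfCSharp

-- opens: exactly the sub-line's (`Lines/F0_P2E3Rung3.lean` v1.1 :105–120), under which the two pasted (C♯) texts elaborate there
open scoped Matrix ComplexOrder
open NumberField NumberField.InfinitePlace IsDedekindDomain MeasureTheory
open Literature.NumberTheory Literature.NumberTheory.Automorphic Literature.NumberTheory.Automorphic.UnitaryGroup
open Literature.NumberTheory.Automorphic.UnitaryGroup.CotangentForms
open Literature.NumberTheory.Automorphic.Liu2021 Literature.NumberTheory.Automorphic.Liu2021.AppendixC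
open Literature.NumberTheory.Automorphic.Liu2021.Def411WeilCarriers
open Literature.NumberTheory.Automorphic.Liu2021.Def411WeilCarriersDoubling
open Literature.NumberTheory.Automorphic.IdeleClassGroup
open Literature.NumberTheory.GelbartRogawski1991 Literature.NumberTheory.GelbartRogawski1991.UnitaryDualPair
open Literature.NumberTheory.GelbartRogawski1991.UnitaryDualPair.WeilCoinv
open Literature.RepresentationTheory Literature.RepresentationTheory.Liu2021
open Literature.NumberTheory.Rogawski1990
open Literature.NumberTheory.QuadraticForms
open Literature.AlgebraicGeometry.Liu2021 (IsAdmissibleElement)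
open Summit.HodgeConjecture.CorCM
open Summit.HodgeConjecture.CorCM.Transposition

/-! ## §1 The admissibility-free Flath bridge: an irreducible SMOOTH `σ` and an irreducible ADMISSIBLE `ω` occurring in one `P` ⟹ `σ ↪ ω` -/

/-- **Flath's uniqueness of the finite component, admissibility-free in `σ`.**  For a discrete automorphic `P` of `U(J)` (any CM datum
`(F, E, c, N, J)`, any automorphic measure): if an irreducible SMOOTH `σ` and an irreducible ADMISSIBLE `ω` both occur in `P` (★ `HasFinComponent`
= an injective `U(J)(𝔸_{F,f})`-intertwiner into `P.finRep`), then there is an INJECTIVE `U(J)(𝔸_{F,f})`-intertwiner `σ → ω` (indeed `σ ≅ ω`).  Proof: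
the smooth part `P_f^∞` is isotypic of type `ω` (★ `F0P3FinPartIsotypic.isIsotypicOfType_finRep_smoothPart`); `σ ↪ P_f^∞` (★
`F0P3FinRepConstituentsExist.exists_intertwiningMap_smoothPart_of_hasFinComponent`), so `σ.asModule` is isotypic of type `ω` (Mathlib
`IsIsotypicOfType.of_injective`) and simple, hence `≃ ω.asModule` over `ℂ[U(J)(𝔸_{F,f})]`; read back as an intertwining map (Mathlib
`Representation.IntertwiningMap.equivLinearMapAsModule`). [cite: FlathCorvallis1979, Thm. 3] [cite: BorelJacquet1979, §4.6]
[cite: BourbakiAlgebreVIII2012, VIII §4 n°1 Prop. 2] [cite: Bump1997, §3.4 Prop. 3.4.1] -/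
theorem exists_injective_intertwiningMap_of_hasFinComponent
    {F E : Type} [Field F] [NumberField F] [Field E] [NumberField E] [Algebra F E] {c : E ≃ₐ[F] E} {N : ℕ}
    {J : Matrix (Fin N) (Fin N) E} {μA : Measure (adelicGroupData F E c N J).automorphicQuotient}
    [(adelicGroupData F E c N J).IsAutomorphicMeasure μA] (P : DiscreteAutomorphicRep (adelicGroupData F E c N J) μA)
    {W : Type} [AddCommGroup W] [Module ℂ W] {σ : Representation ℂ (finAdelic F E c N J) W}
    (hσirr : σ.IsIrreducible) (hσsm : σ.IsSmooth) (hPσ : P.HasFinComponent σ)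
    {W' : Type} [AddCommGroup W'] [Module ℂ W'] {ω : Representation ℂ (finAdelic F E c N J) W'}
    (hωirr : ω.IsIrreducible) (hωadm : ω.IsAdmissible) (hPω : P.HasFinComponent ω) :
    ∃ f : σ.IntertwiningMap ω, Function.Injective f := by
  -- `σ ↪ P_f^∞` (σ is smooth)
  obtain ⟨f₁, hf₁⟩ := F0P3FinRepConstituentsExist.exists_intertwiningMap_smoothPart_of_hasFinComponent P hσsm hPσ
  -- `P_f^∞` is isotypic of type `ω` (P3 brick I♭; uses the admissibility of `ω` only)
  have hS := F0P3FinPartIsotypic.isIsotypicOfType_finRep_smoothPart P ω hωirr hωadm hPω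
  -- pull the isotypy back to `σ.asModule` along the `ℂ[G]`-linear form of `f₁`
  have hF₁ : Function.Injective (Representation.IntertwiningMap.equivLinearMapAsModule _ _ f₁) := hf₁
  have hσiso := hS.of_injective _ hF₁
  -- `σ.asModule` is simple, so `⊤ ≃ ω.asModule`
  haveI := (Representation.irreducible_iff_isSimpleModule_asModule _).mp hσirr
  haveI : IsSimpleModule (MonoidAlgebra ℂ (finAdelic F E c N J)) (⊤ : Submodule (MonoidAlgebra ℂ (finAdelic F E c N J)) σ.asModule) :=
    IsSimpleModule.congr Submodule.topEquiv
  obtain ⟨e⟩ := hσiso ⊤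
  -- back to an equivariant `ℂ`-linear map
  refine ⟨(Representation.IntertwiningMap.equivLinearMapAsModule _ _).symm (Submodule.topEquiv.symm.trans e).toLinearMap, ?_⟩
  exact (Submodule.topEquiv.symm.trans e).injective

/-! ## §2 The head — letter (C) from the two registered (C♯) stubs -/

set_option synthInstance.maxHeartbeats 400000 in
set_option maxHeartbeats 16000000 in
/-- **(C) ⟸ (C♯)hol + conj.**  Hypotheses: `hH` = the body of `F0P2E3Rung3.StubCSharpHol` (`Lines/F0_P2E3Rung3.lean` v1.1 :221–248) VERBATIM and
`hA` = `‹StubCSharpHol› → ‹StubCSharpAntihol :256–283›` VERBATIM (so the sub-line's `stub_CSharp_hol`, `stub_CSharp_antihol_of_hol` — or the planner's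
(α) letters `cohFinComponent_isThetaSigned_hol ∕ _antihol` — plug in BY NAME); conclusion: the UNSIGNED letter (C) ★
`Literature.NumberTheory.Rogawski1990.cohFinComponent_isTheta` BY NAME.  Proof: case on the Hodge type of `P` to get the signed datum `(μ, a, χ)` with
`P.HasFinComponent ω_H(μ, a, χ)`; drop the sign; the carrier is irreducible admissible (★ CI road, `N = 3`); §1 gives `σ ↪ ω_H(μ, a, χ)`.
[cite: Liu2021, Prop. 4.13 (proof l. 2131–2149), Def. 4.11, App. D Lem. D.1 (1)] [cite: Rogawski1990, Thm. 13.3.6 (c), §15.3 ¶1]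
[cite: FlathCorvallis1979, Thm. 3, Thm. 4] [cite: BorelJacquet1979, §4.6] -/
theorem cohFinComponent_isTheta_of_cSharp
    (hH :
      ∀ (L : Type) [Field L] [NumberField L] [IsCMField L] (ι : L →+* ℂ) (H : Matrix (Fin 3) (Fin 3) L) (T : GL (Fin 3) ℂ)
        (hT : (T : Matrix (Fin 3) (Fin 3) ℂ)ᴴ * H.map ι * (T : Matrix (Fin 3) (Fin 3) ℂ) = Literature.Geometry.ComplexHyperbolic.BallModel.J),
        (∀ τ' : L →+* ℂ, InfinitePlace.mk τ' ≠ InfinitePlace.mk ι → (H.map τ').PosDef) → 2 ≤ Module.finrank ℚ ↥(maximalRealSubfield L) →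
        ∀ {n' : ℕ} (e₁ : Fin 3 × Fin 1 ≃ Fin n') (dV : Fin 3 → L) (hdV : ∀ i, IsCMField.complexConj L (dV i) = dV i)
          (hdV0 : ∀ i, dV i ≠ 0) (g : GL (Fin 3) L)
          (hg : ((g : Matrix (Fin 3) (Fin 3) L).map (cmConjRingHom L))ᵀ * H * (g : Matrix (Fin 3) (Fin 3) L) = Matrix.diagonal dV)
          (ιV : finAdelic (↥(maximalRealSubfield L)) L (IsCMField.complexConj L) 3 H →*
              finAdelic (↥(maximalRealSubfield L)) L (IsCMField.complexConj L) 3 (Matrix.diagonal dV)),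
            (∀ k, ((ιV k : finAdelic (↥(maximalRealSubfield L)) L (IsCMField.complexConj L) 3 (Matrix.diagonal dV)) :
                GL (Fin 3) (FiniteAdeleRing (𝓞 L) L)) =
              (toFinAdeleGL L 3 g)⁻¹ * (k : GL (Fin 3) (FiniteAdeleRing (𝓞 L) L)) * toFinAdeleGL L 3 g) →
            ∀ (μA : Measure (adelicGroupData (↥(maximalRealSubfield L)) L (IsCMField.complexConj L) 3 H).automorphicQuotient)
              [(adelicGroupData (↥(maximalRealSubfield L)) L (IsCMField.complexConj L) 3 H).IsAutomorphicMeasure μA],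
              ∀ P : DiscreteAutomorphicRep (adelicGroupData (↥(maximalRealSubfield L)) L (IsCMField.complexConj L) 3 H) μA,
                P.IsHolCotangentAt (cmArchSection L ι H T hT) (cmCompactFactor L ι H T hT) →
                  ∃ (μ : Literature.NumberTheory.Automorphic.IdeleClassGroup L →ₜ* Circle) (hμ : IsConjugateSymplectic L μ),
                    HasWeight L μ 1 ∧
                    ∃ (a : (↥(maximalRealSubfield L))ˣ) (χ : Chi (↥(maximalRealSubfield L)) L (IsCMField.complexConj L)),
                      IsAdmissibleElement L hμ.cmType.1 (algebraMap (↥(maximalRealSubfield L)) L a * (2 * imagUnit L)⁻¹) ∧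
                        P.HasFinComponent
                      (rhoAtLine (↥(maximalRealSubfield L)) L (IsCMField.complexConj L) 3 e₁ (Matrix.diagonal dV)
                        (complexConj_imagUnit L) (imagUnit_ne_zero L) (imagUnit_mul_self L) (realDiagonal_isSymm L dV hdV)
                        (isUnit_det_realDiagonal L dV hdV hdV0) (realDiagonal_map L dV hdV).symm
                        (fun a => isCompatible_chiSplittingLine L e₁ dV hdV hdV0 (toHeckeCharacter L μ)
                          (isUnitary_toHeckeCharacter L μ) ((isOscillatorChar_toHeckeCharacter_iff μ).mpr hμ)
                          (TW (↥(maximalRealSubfield L)) a) (isSymm_TW (↥(maximalRealSubfield L)) a)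
                          (isUnit_det_TW (↥(maximalRealSubfield L)) a) (JW (↥(maximalRealSubfield L)) L a)
                          (JW_eq (↥(maximalRealSubfield L)) L a)) ιV a χ))
    (hA :
      (∀ (L : Type) [Field L] [NumberField L] [IsCMField L] (ι : L →+* ℂ) (H : Matrix (Fin 3) (Fin 3) L) (T : GL (Fin 3) ℂ)
          (hT : (T : Matrix (Fin 3) (Fin 3) ℂ)ᴴ * H.map ι * (T : Matrix (Fin 3) (Fin 3) ℂ) = Literature.Geometry.ComplexHyperbolic.BallModel.J),
          (∀ τ' : L →+* ℂ, InfinitePlace.mk τ' ≠ InfinitePlace.mk ι → (H.map τ').PosDef) → 2 ≤ Module.finrank ℚ ↥(maximalRealSubfield L) →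
          ∀ {n' : ℕ} (e₁ : Fin 3 × Fin 1 ≃ Fin n') (dV : Fin 3 → L) (hdV : ∀ i, IsCMField.complexConj L (dV i) = dV i)
            (hdV0 : ∀ i, dV i ≠ 0) (g : GL (Fin 3) L)
            (hg : ((g : Matrix (Fin 3) (Fin 3) L).map (cmConjRingHom L))ᵀ * H * (g : Matrix (Fin 3) (Fin 3) L) = Matrix.diagonal dV)
            (ιV : finAdelic (↥(maximalRealSubfield L)) L (IsCMField.complexConj L) 3 H →*
                finAdelic (↥(maximalRealSubfield L)) L (IsCMField.complexConj L) 3 (Matrix.diagonal dV)),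
              (∀ k, ((ιV k : finAdelic (↥(maximalRealSubfield L)) L (IsCMField.complexConj L) 3 (Matrix.diagonal dV)) :
                  GL (Fin 3) (FiniteAdeleRing (𝓞 L) L)) =
                (toFinAdeleGL L 3 g)⁻¹ * (k : GL (Fin 3) (FiniteAdeleRing (𝓞 L) L)) * toFinAdeleGL L 3 g) →
              ∀ (μA : Measure (adelicGroupData (↥(maximalRealSubfield L)) L (IsCMField.complexConj L) 3 H).automorphicQuotient)
                [(adelicGroupData (↥(maximalRealSubfield L)) L (IsCMField.complexConj L) 3 H).IsAutomorphicMeasure μA],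
                ∀ P : DiscreteAutomorphicRep (adelicGroupData (↥(maximalRealSubfield L)) L (IsCMField.complexConj L) 3 H) μA,
                  P.IsHolCotangentAt (cmArchSection L ι H T hT) (cmCompactFactor L ι H T hT) →
                    ∃ (μ : Literature.NumberTheory.Automorphic.IdeleClassGroup L →ₜ* Circle) (hμ : IsConjugateSymplectic L μ),
                      HasWeight L μ 1 ∧
                      ∃ (a : (↥(maximalRealSubfield L))ˣ) (χ : Chi (↥(maximalRealSubfield L)) L (IsCMField.complexConj L)),
                        IsAdmissibleElement L hμ.cmType.1 (algebraMap (↥(maximalRealSubfield L)) L a * (2 * imagUnit L)⁻¹) ∧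
                          P.HasFinComponent
                        (rhoAtLine (↥(maximalRealSubfield L)) L (IsCMField.complexConj L) 3 e₁ (Matrix.diagonal dV)
                          (complexConj_imagUnit L) (imagUnit_ne_zero L) (imagUnit_mul_self L) (realDiagonal_isSymm L dV hdV)
                          (isUnit_det_realDiagonal L dV hdV hdV0) (realDiagonal_map L dV hdV).symm
                          (fun a => isCompatible_chiSplittingLine L e₁ dV hdV hdV0 (toHeckeCharacter L μ)
                            (isUnitary_toHeckeCharacter L μ) ((isOscillatorChar_toHeckeCharacter_iff μ).mpr hμ)
                            (TW (↥(maximalRealSubfield L)) a) (isSymm_TW (↥(maximalRealSubfield L)) a)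
                            (isUnit_det_TW (↥(maximalRealSubfield L)) a) (JW (↥(maximalRealSubfield L)) L a)
                            (JW_eq (↥(maximalRealSubfield L)) L a)) ιV a χ)) →
        ∀ (L : Type) [Field L] [NumberField L] [IsCMField L] (ι : L →+* ℂ) (H : Matrix (Fin 3) (Fin 3) L) (T : GL (Fin 3) ℂ)
          (hT : (T : Matrix (Fin 3) (Fin 3) ℂ)ᴴ * H.map ι * (T : Matrix (Fin 3) (Fin 3) ℂ) = Literature.Geometry.ComplexHyperbolic.BallModel.J),
          (∀ τ' : L →+* ℂ, InfinitePlace.mk τ' ≠ InfinitePlace.mk ι → (H.map τ').PosDef) → 2 ≤ Module.finrank ℚ ↥(maximalRealSubfield L) →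
          ∀ {n' : ℕ} (e₁ : Fin 3 × Fin 1 ≃ Fin n') (dV : Fin 3 → L) (hdV : ∀ i, IsCMField.complexConj L (dV i) = dV i)
            (hdV0 : ∀ i, dV i ≠ 0) (g : GL (Fin 3) L)
            (hg : ((g : Matrix (Fin 3) (Fin 3) L).map (cmConjRingHom L))ᵀ * H * (g : Matrix (Fin 3) (Fin 3) L) = Matrix.diagonal dV)
            (ιV : finAdelic (↥(maximalRealSubfield L)) L (IsCMField.complexConj L) 3 H →*
                finAdelic (↥(maximalRealSubfield L)) L (IsCMField.complexConj L) 3 (Matrix.diagonal dV)),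
              (∀ k, ((ιV k : finAdelic (↥(maximalRealSubfield L)) L (IsCMField.complexConj L) 3 (Matrix.diagonal dV)) :
                  GL (Fin 3) (FiniteAdeleRing (𝓞 L) L)) =
                (toFinAdeleGL L 3 g)⁻¹ * (k : GL (Fin 3) (FiniteAdeleRing (𝓞 L) L)) * toFinAdeleGL L 3 g) →
              ∀ (μA : Measure (adelicGroupData (↥(maximalRealSubfield L)) L (IsCMField.complexConj L) 3 H).automorphicQuotient)
                [(adelicGroupData (↥(maximalRealSubfield L)) L (IsCMField.complexConj L) 3 H).IsAutomorphicMeasure μA],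
                ∀ P : DiscreteAutomorphicRep (adelicGroupData (↥(maximalRealSubfield L)) L (IsCMField.complexConj L) 3 H) μA,
                  P.IsAntiholCotangentAt (cmArchSection L ι H T hT) (cmCompactFactor L ι H T hT) →
                    ∃ (μ : Literature.NumberTheory.Automorphic.IdeleClassGroup L →ₜ* Circle) (hμ : IsConjugateSymplectic L μ),
                      HasWeight L μ 1 ∧
                      ∃ (a : (↥(maximalRealSubfield L))ˣ) (χ : Chi (↥(maximalRealSubfield L)) L (IsCMField.complexConj L)),
                        IsAdmissibleElement L hμ.cmType.1 (algebraMap (↥(maximalRealSubfield L)) L a * (2 * imagUnit L)⁻¹) ∧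
                          P.HasFinComponent
                        (rhoAtLine (↥(maximalRealSubfield L)) L (IsCMField.complexConj L) 3 e₁ (Matrix.diagonal dV)
                          (complexConj_imagUnit L) (imagUnit_ne_zero L) (imagUnit_mul_self L) (realDiagonal_isSymm L dV hdV)
                          (isUnit_det_realDiagonal L dV hdV hdV0) (realDiagonal_map L dV hdV).symm
                          (fun a => isCompatible_chiSplittingLine L e₁ dV hdV hdV0 (toHeckeCharacter L μ)
                            (isUnitary_toHeckeCharacter L μ) ((isOscillatorChar_toHeckeCharacter_iff μ).mpr hμ)
                            (TW (↥(maximalRealSubfield L)) a) (isSymm_TW (↥(maximalRealSubfield L)) a)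
                            (isUnit_det_TW (↥(maximalRealSubfield L)) a) (JW (↥(maximalRealSubfield L)) L a)
                            (JW_eq (↥(maximalRealSubfield L)) L a)) ιV a χ)) :
    Literature.NumberTheory.Rogawski1990.cohFinComponent_isTheta := by
  intro L _ _ _ ι H T hT hdef h2 n' e₁ dV hdV hdV0 g hg ιV hιV μA _ W _ _ σ hσirr hσsm P hP hPσ
  -- the signed theta datum of `P` (case split on the Hodge type at `ι`)
  have hC := hP.elim (hH L ι H T hT hdef h2 e₁ dV hdV hdV0 g hg ιV hιV μA P)
    (hA hH L ι H T hT hdef h2 e₁ dV hdV hdV0 g hg ιV hιV μA P)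
  obtain ⟨μ, hμ, hw, a, χ, -, hPω⟩ := hC
  -- the carrier `ω_H(μ, a, χ)` is irreducible and admissible (★ CI road)
  have hirr := F0P2cStubCI.rhoAtLine_chi_isIrreducible L H e₁ dV hdV hdV0 g hg ιV hιV μ hμ a χ
  have hadm := F0P2cStubCI.rhoAtLine_chi_isAdmissible L H e₁ dV hdV hdV0 g hg ιV hιV μ hμ a χ
  -- Flath's bridge, admissibility-free in `σ`
  obtain ⟨f, hf⟩ := exists_injective_intertwiningMap_of_hasFinComponent P hσirr hσsm hPσ hirr hadm hPω
  exact ⟨μ, hμ, hw, a, χ, f, hf⟩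

end Summit.HodgeConjecture.HodgeConjecture.Cruxes.H413.F0P2mCOfCSharp

end
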